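import Mathlib
import Summits.NavierStokesRegularity.NavierStokesRegularity.Theorems.TaoLadderRungTwoBreakOneShiftWindowResidualSlope
import HarnessLib

/-!
# The one-shift window system, XII: the Krawczyk hypotheses (K2) (tail Lipschitz) and (K3) (centre residual) from
# RUN-LEVEL statements — tail sensitivity and hull of the window run at the flight time — plus finite checks
# (cell harvest/h2-tao-ladder, seat p2; rung1/KERNEL-CHEAP-REPLAY-SPEC.md §3 S5, rung1/RUNG1-P2G12-REPORT.md §53;
# support for K1(1) = `NoSurvivingDSSOne`, stmt-NavierStokesRegularity-20205)

MODEL lattice ODEs only (Tao 2016 §4 normal form on Tao's shift set `S`); nothing here is a statement about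
the Navier–Stokes equations; no item is closed; nothing numerical is proved.

Part V (…OneShiftWindowKrawczyk) reduced the two Krawczyk clauses of the certificate side to (K1)–(K3); parts X/XI
reduced (K1) to a run slope + interval algebra. This file does the same for the remaining two:

* `resFormula z Ttop y` — the residual as a FORMULA of the window run `z` at the flight time, the top-tail values
  `Ttop` there and the window start `y`; `gval_eq_resFormula`;
* (K3) `K3_of_residualEnclosure` (an enclosure `G(u) ∈ [Glo, Ghi]` at the box centre over all tails + the
  finite check `|Σ_{r'} Cmat r r' G r'| / S_r ≤ Y` for all `G` in the box) and `K3_of_centreRun` (the enclosure from a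
  HULL of the centre run at the flight time, `zlo ≤ runAt u ≤ zhi`, and the top tube, the check now quantified over
  that hull — an interval evaluation of `resFormula`);
* (K2) `abs_resFormula_sub_le` (row-wise Lipschitz moduli `resLip` of the residual formula in the run and the top
  tail at a common window start: `|g| ≤ eLo^{-1/2}`, `|γ| ≤ ½ eLo^{-3/2}` via the rsqrt slope of part XI, hull
  magnitudes `A`, top tube `TW`), `resLip_linear`, and `K2_of_runTailSensitivity`: a TAIL-SENSITIVITY bound of the run
  at the flight time, `|runAt u − runAt v|_{i,k} ≤ χb_{i,k} B + χe_{i,k} E` for points with the same window part whose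
  wake / top tails differ by at most `B` / `E` (a Grönwall statement an integrator proves), hull magnitudes and a
  shell-1 energy floor, and the two finite checks `Σ_{r'} |Cmat r r'| GB r' / S_r ≤ S_b`, `… GE … ≤ S_e` ⇒ (K2).

With parts VI, X, XI this completes the reduction of EVERY clause of `T4W76.ClausesFor` & co. to statements of
integrator shape (C⁰ hulls of all runs, tail sensitivities, run slopes at equal tails) plus finite checks.
-/

noncomputable section

-- the sub-problem namespace repeats the summit name by design (D-0017)
set_option linter.dupNamespace false

namespace Summit.NavierStokesRegularity.NavierStokesRegularity.Theorems

namespace DSSOneShift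

open Set Metric Literature.Analysis.FluidPDE Literature.Analysis.FluidPDE.TaoCascade CertificateGlueOn

variable {m : ℕ}

/-! ### Magnitude bounds of the renormalisation factor and of the rsqrt slope above an energy floor -/

/-- `|rsqrtDeriv θ| ≤ (1/(2√eLo))/eLo` for `θ ≥ eLo > 0` (`½ θ^{-3/2}` is decreasing). [folklore] -/
theorem abs_rsqrtDeriv_le {eLo θ : ℝ} (h0 : 0 < eLo) (h : eLo ≤ θ) :
    |rsqrtDeriv θ| ≤ (1 / (2 * Real.sqrt eLo)) / eLo := by
  have hθ : 0 < θ := h0.trans_le h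
  have hsθ : 0 < Real.sqrt θ := Real.sqrt_pos.2 hθ
  have hs0 : 0 < Real.sqrt eLo := Real.sqrt_pos.2 h0
  have e1 : rsqrtDeriv θ = -((1 / (2 * Real.sqrt θ)) / θ) := by
    rw [rsqrtDeriv, Real.sq_sqrt hθ.le]; ring
  rw [e1, abs_neg, abs_of_nonneg (by positivity)]
  have h1 : 1 / (2 * Real.sqrt θ) ≤ 1 / (2 * Real.sqrt eLo) :=
    one_div_le_one_div_of_le (by positivity) (by linarith [Real.sqrt_le_sqrt h])
  exact div_le_div₀ (by positivity) h1 h0 h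

/-- `0 ≤ gfac z` and `gfac z ≤ (√eLo)⁻¹` when the shell-1 energy is at least `eLo > 0`. [folklore] -/
theorem abs_gfac_le {z : Fin m → ℤ → ℝ} {eLo : ℝ} (h0 : 0 < eLo) (h : eLo ≤ ∑ i, z i 1 ^ 2) :
    |gfac z| ≤ (Real.sqrt eLo)⁻¹ := by
  rw [gfac, abs_of_nonneg (inv_nonneg.2 (Real.sqrt_nonneg _))]
  exact inv_anti₀ (Real.sqrt_pos.2 h0) (Real.sqrt_le_sqrt h)

namespace OneShiftFrame

variable (F : OneShiftFrame m)

/-! ### The residual as a formula -/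

/-- **The residual as a formula** of the window run `z` at the flight time, the top-tail values `Ttop` there and
the window start `y`: one-shift rows `g(z) z_{i,j+1} − y_{i,j}`, top rows `g(z) Ttop_i − y_{i,j}`, section row
`e(z_D) − strig`. [cite: Tao2016AveragedNS, §5.3; cell vocabulary, harvest/h2-tao-ladder rung1/STAGE2-LEMMA.md §2 (G)] -/
def resFormula (z : Fin m → ℤ → ℝ) (Ttop : Fin m → ℝ) (y : Fin m → ℤ → ℝ) : F.WState × ℝ :=
  (fun i j =>
      if ((j : ℕ) : ℤ) + 1 < F.W then gfac z * z i (((j : ℕ) : ℤ) + 1) - y i ((j : ℕ) : ℤ)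
      else gfac z * Ttop i - y i ((j : ℕ) : ℤ),
    shellEnergy z F.D - F.strig)

/-- The residual of a point IS the formula at (its run at the flight time, its top tail there, its window start).
[folklore] -/
theorem gval_eq_resFormula (ε₀ : ℝ) (α : Fin m → Fin m → Fin m → ℤ × ℤ × ℤ → ℝ) (u : F.Space) :
    F.gval ε₀ α u =
      F.resFormula (F.runAt ε₀ α u) (fun i => F.preclampTail u i F.W (F.preclampTau u)) (F.preclampY u) := by
  refine Prod.ext (funext fun i => funext fun j => ?_) ?_
  · by_cases hj : ((j : ℕ) : ℤ) + 1 < F.W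
    · rw [F.gval_fst_of_lt ε₀ α u i j hj]; simp only [resFormula, if_pos hj]
    · rw [F.gval_fst_of_not_lt ε₀ α u i j hj]; simp only [resFormula, if_neg hj]
  · rw [F.gval_snd]; rfl

/-- The formula reads the window start only on the window: starts that agree there give the same residual.
[folklore] -/
theorem resFormula_congr_y (z : Fin m → ℤ → ℝ) (Ttop : Fin m → ℝ) {y y' : Fin m → ℤ → ℝ}
    (h : ∀ i (j : Fin F.W), y i ((j : ℕ) : ℤ) = y' i ((j : ℕ) : ℤ)) :
    F.resFormula z Ttop y = F.resFormula z Ttop y' := by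
  refine Prod.ext (funext fun i => funext fun j => ?_) rfl
  simp only [resFormula, h i j]

/-- The pre-clamped top tail of an admissible point lies in the top tube at the flight time. [folklore] -/
theorem abs_preclampTail_top_sub_le {u : F.Space} (hu : F.Adm u) (i : Fin m) :
    |F.preclampTail u i F.W (F.preclampTau u) - F.tubeC i F.W| ≤ F.tubeR F.W := by
  have hWout : ¬ F.InWindow F.W := fun h => lt_irrefl _ h.2
  rw [F.preclampTail_eq_decodeTail hu i hWout]
  exact hu.2.2.2.1 i F.W hWout _ (F.preclampTau_mem u)

/-! ### (K3): the centre residual -/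

/-- **(K3) FROM A RESIDUAL ENCLOSURE AT THE CENTRE.** Linear preconditioner `Cmat`; an enclosure
`Glo ≤ coord (G u) ≤ Ghi` for every `AdmLip` point at the box centre (`ξ_u = 0`, any tails); and the finite check
`|Σ_{r'} Cmat r r' G r'| / S_r ≤ Y` for EVERY `G ∈ [Glo, Ghi]` (interval linear algebra). Then (K3) in the form consumed
by `krawczyk_winIn` (part V). [cite: Tao2016AveragedNS, §5.3; cell vocabulary, harvest/h2-tao-ladder rung1/STAGE2-LEMMA.md §3 (‖C G(x̂)‖ ≤ Y), rung1/KERNEL-CHEAP-REPLAY-SPEC.md §2 (Krawczyk file, b = C·Gc/s)] -/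
theorem K3_of_residualEnclosure {ε₀ : ℝ} {α : Fin m → Fin m → Fin m → ℤ × ℤ × ℤ → ℝ}
    (C : F.WState × ℝ → F.WState × ℝ) {Cmat : F.WIdx → F.WIdx → ℝ}
    (hC : ∀ x r, F.coord (C x) r = ∑ r', Cmat r r' * F.coord x r') (R : ℤ → ℝ) {Y : ℝ} (Glo Ghi : F.WIdx → ℝ)
    (hG : ∀ u, F.AdmLip R u → u.1 = 0 → u.2.1 = 0 →
      ∀ r, Glo r ≤ F.coord (F.gval ε₀ α u) r ∧ F.coord (F.gval ε₀ α u) r ≤ Ghi r)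
    (hY : ∀ G : F.WIdx → ℝ, (∀ r, Glo r ≤ G r ∧ G r ≤ Ghi r) → ∀ r, |(∑ r', Cmat r r' * G r') / F.bscale r| ≤ Y) :
    ∀ u, F.AdmLip R u → u.1 = 0 → u.2.1 = 0 →
      (∀ i j, |(F.precondResidual ε₀ α C u).1 i j| ≤ Y) ∧ |(F.precondResidual ε₀ α C u).2| ≤ Y := by
  intro u hu h1 h2
  have key : ∀ r, |F.coord (F.precondResidual ε₀ α C u) r| ≤ Y := fun r => by
    rw [F.coord_precondResidual, hC]
    exact hY _ (hG u hu h1 h2) r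
  exact ⟨fun i j => by simpa using key (some (i, j)), by simpa using key none⟩

/-- **(K3) FROM A HULL OF THE CENTRE RUN.** If the window run of every `AdmLip` point at the box centre (any tails)
satisfies `zlo ≤ runAt u ≤ zhi` on the window at its flight time, and the finite check
`|Σ_{r'} Cmat r r' · coord (resFormula z Ttop ŷ) r'| / S_r ≤ Y` holds for EVERY `z` in that hull and every `Ttop` in
the top tube (an interval evaluation of `resFormula`), then (K3). [cite: Tao2016AveragedNS, §5.3; cell vocabulary, harvest/h2-tao-ladder rung1/STAGE2-LEMMA.md §3, rung1/KERNEL-CHEAP-REPLAY-SPEC.md §2 (Gc := G(z_C ± D_C))] -/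
theorem K3_of_centreRun {ε₀ : ℝ} {α : Fin m → Fin m → Fin m → ℤ × ℤ × ℤ → ℝ}
    (C : F.WState × ℝ → F.WState × ℝ) {Cmat : F.WIdx → F.WIdx → ℝ}
    (hC : ∀ x r, F.coord (C x) r = ∑ r', Cmat r r' * F.coord x r') (R : ℤ → ℝ) {Y : ℝ}
    (zlo zhi : Fin m → ℤ → ℝ)
    (hz : ∀ u, F.AdmLip R u → u.1 = 0 → u.2.1 = 0 →
      ∀ i k, F.InWindow k → zlo i k ≤ F.runAt ε₀ α u i k ∧ F.runAt ε₀ α u i k ≤ zhi i k)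
    (hY : ∀ (z : Fin m → ℤ → ℝ) (Ttop : Fin m → ℝ),
      (∀ i k, F.InWindow k → zlo i k ≤ z i k ∧ z i k ≤ zhi i k) → (∀ i, |Ttop i - F.tubeC i F.W| ≤ F.tubeR F.W) →
      ∀ r, |(∑ r', Cmat r r' * F.coord (F.resFormula z Ttop F.yc) r') / F.bscale r| ≤ Y) :
    ∀ u, F.AdmLip R u → u.1 = 0 → u.2.1 = 0 →
      (∀ i j, |(F.precondResidual ε₀ α C u).1 i j| ≤ Y) ∧ |(F.precondResidual ε₀ α C u).2| ≤ Y := by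
  intro u hu h1 h2
  -- at the centre the pre-clamped window start is `ŷ` on the window
  have hy : ∀ i (j : Fin F.W), F.preclampY u i ((j : ℕ) : ℤ) = F.yc i ((j : ℕ) : ℤ) := fun i j => by
    rw [F.preclampY_natCast, h1]
    simp [clampUnit_of_abs_le (show |(0 : ℝ)| ≤ 1 by simp)]
  have hG : F.gval ε₀ α u =
      F.resFormula (F.runAt ε₀ α u) (fun i => F.preclampTail u i F.W (F.preclampTau u)) F.yc := by
    rw [F.gval_eq_resFormula, F.resFormula_congr_y _ _ hy]
  have key : ∀ r, |F.coord (F.precondResidual ε₀ α C u) r| ≤ Y := fun r => by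
    rw [F.coord_precondResidual, hC, hG]
    exact hY _ _ (hz u hu h1 h2) (F.abs_preclampTail_top_sub_le hu.1) r
  exact ⟨fun i j => by simpa using key (some (i, j)), by simpa using key none⟩

/-! ### (K2): tail Lipschitz bounds -/

/-- The shell-1 coupling modulus `H = Σ_i 2 A_{i,1} δz_{i,1}` (bound of the slope of the shell-1 energy). [folklore] -/
def hmod (A δz : Fin m → ℤ → ℝ) : ℝ := ∑ i, 2 * A i 1 * δz i 1

/-- **Row-wise Lipschitz moduli of the residual formula** at a common window start, in the run difference `δz` and
the top-tail difference `δT`: one-shift rows `eLo^{-1/2} δz_{i,j+1} + A_{i,j+1} γmax H`, top rows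
`eLo^{-1/2} δT + TW_i γmax H`, section row `Σ_i A_{i,D} δz_{i,D}` (`γmax = (1/(2√eLo))/eLo`).
[cite: Tao2016AveragedNS, §5.3; cell vocabulary, harvest/h2-tao-ladder rung1/STAGE3-BANACH.md §2 ((H-lip) tail columns), rung1/RUNG1-P2G9-REPORT.md §37 (S_b, S_e)] -/
def resLip (A : Fin m → ℤ → ℝ) (eLo : ℝ) (TW : Fin m → ℝ) (δz : Fin m → ℤ → ℝ) (δT : ℝ) : F.WIdx → ℝ :=
  fun r =>
    match r with
    | some (i, j) =>
        if ((j : ℕ) : ℤ) + 1 < F.W then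
          (Real.sqrt eLo)⁻¹ * δz i (((j : ℕ) : ℤ) + 1) +
            A i (((j : ℕ) : ℤ) + 1) * ((1 / (2 * Real.sqrt eLo)) / eLo) * hmod A δz
        else (Real.sqrt eLo)⁻¹ * δT + TW i * ((1 / (2 * Real.sqrt eLo)) / eLo) * hmod A δz
    | none => ∑ i, A i F.D * δz i F.D

/-- **The residual formula is row-wise Lipschitz** in (run, top tail) at a common window start, with moduli
`resLip`: hull magnitudes `|z|, |z'| ≤ A` on the window, shell-1 energies `≥ eLo > 0`, `|Ttop'| ≤ TW`, differences
`|z − z'| ≤ δz`, `|Ttop − Ttop'| ≤ δT`; the window contains the shells `1` and `D`.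
[cite: Tao2016AveragedNS, §5.3; cell vocabulary, harvest/h2-tao-ladder rung1/STAGE3-BANACH.md §2] -/
theorem abs_resFormula_sub_le (hW1 : F.InWindow 1) (hD : F.InWindow F.D) {A : Fin m → ℤ → ℝ} {eLo : ℝ}
    (heLo : 0 < eLo) {TW : Fin m → ℝ} {δz : Fin m → ℤ → ℝ} {δT : ℝ} {z z' : Fin m → ℤ → ℝ}
    {Ttop Ttop' : Fin m → ℝ} (y : Fin m → ℤ → ℝ)
    (hzA : ∀ i k, F.InWindow k → |z i k| ≤ A i k) (hz'A : ∀ i k, F.InWindow k → |z' i k| ≤ A i k)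
    (he : eLo ≤ ∑ i, z i 1 ^ 2) (he' : eLo ≤ ∑ i, z' i 1 ^ 2) (hT' : ∀ i, |Ttop' i| ≤ TW i)
    (hδz : ∀ i k, F.InWindow k → |z i k - z' i k| ≤ δz i k) (hδT : ∀ i, |Ttop i - Ttop' i| ≤ δT) :
    ∀ r, |F.coord (F.resFormula z Ttop y) r - F.coord (F.resFormula z' Ttop' y) r| ≤ F.resLip A eLo TW δz δT r := by
  classical
  -- the rsqrt slope between the two shell-1 energies and its magnitude
  obtain ⟨θ, hθmem, hθpos, hθ⟩ := exists_rsqrt_slope (heLo.trans_le he) (heLo.trans_le he')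
  have hθlo : eLo ≤ θ := by
    rcases le_total (∑ i, z' i 1 ^ 2) (∑ i, z i 1 ^ 2) with hle | hle
    · rw [uIcc_of_le hle] at hθmem; exact he'.trans hθmem.1
    · rw [uIcc_of_ge hle] at hθmem; exact he.trans hθmem.1
  have hγ : |rsqrtDeriv θ| ≤ (1 / (2 * Real.sqrt eLo)) / eLo := abs_rsqrtDeriv_le heLo hθlo
  have hg : |gfac z| ≤ (Real.sqrt eLo)⁻¹ := abs_gfac_le heLo he
  -- the shell-1 energy difference
  have hH : |∑ i, z i 1 ^ 2 - ∑ i, z' i 1 ^ 2| ≤ hmod A δz := by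
    rw [OneShiftFrame.sum_sq_sub_sum_sq, hmod]
    refine (Finset.abs_sum_le_sum_abs _ _).trans (Finset.sum_le_sum fun i _ => ?_)
    rw [abs_mul]
    have h1 : |z i 1 + z' i 1| ≤ 2 * A i 1 :=
      (abs_add_le _ _).trans (by linarith [hzA i 1 hW1, hz'A i 1 hW1])
    exact mul_le_mul h1 (hδz i 1 hW1) (abs_nonneg _) (by linarith [abs_nonneg (z i 1 + z' i 1)])
  have hgg : |gfac z - gfac z'| ≤ (1 / (2 * Real.sqrt eLo)) / eLo * hmod A δz := by
    have e1 : gfac z - gfac z' = rsqrtDeriv θ * (∑ i, z i 1 ^ 2 - ∑ i, z' i 1 ^ 2) := hθ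
    rw [e1, abs_mul]
    exact mul_le_mul hγ hH (abs_nonneg _) (by positivity)
  have hA0 : ∀ i k, F.InWindow k → 0 ≤ A i k := fun i k hk => (abs_nonneg _).trans (hzA i k hk)
  intro r
  rcases r with _ | ⟨i, j⟩
  · -- section row
    simp only [coord_none, resFormula, resLip, shellEnergy]
    rw [show (1 / 2 : ℝ) * ∑ i, z i F.D ^ 2 - F.strig - ((1 / 2) * ∑ i, z' i F.D ^ 2 - F.strig) =
      (1 / 2) * (∑ i, z i F.D ^ 2 - ∑ i, z' i F.D ^ 2) by ring, OneShiftFrame.sum_sq_sub_sum_sq, abs_mul,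
      abs_of_pos (by norm_num : (0 : ℝ) < 1 / 2)]
    have h2 : |∑ i, (z i F.D + z' i F.D) * (z i F.D - z' i F.D)| ≤ ∑ i, 2 * A i F.D * δz i F.D := by
      refine (Finset.abs_sum_le_sum_abs _ _).trans (Finset.sum_le_sum fun i _ => ?_)
      rw [abs_mul]
      have h1 : |z i F.D + z' i F.D| ≤ 2 * A i F.D :=
        (abs_add_le _ _).trans (by linarith [hzA i F.D hD, hz'A i F.D hD])
      exact mul_le_mul h1 (hδz i F.D hD) (abs_nonneg _) (by linarith [abs_nonneg (z i F.D + z' i F.D)])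
    have h3 : ∑ i, 2 * A i F.D * δz i F.D = 2 * ∑ i, A i F.D * δz i F.D := by
      rw [Finset.mul_sum]; exact Finset.sum_congr rfl fun i _ => by ring
    linarith
  · by_cases hj : ((j : ℕ) : ℤ) + 1 < F.W
    · -- one-shift row
      have hk : F.InWindow (((j : ℕ) : ℤ) + 1) := ⟨by positivity, hj⟩
      simp only [coord_some, resFormula, resLip, if_pos hj]
      set k : ℤ := ((j : ℕ) : ℤ) + 1
      have e1 : gfac z * z i k - y i ((j : ℕ) : ℤ) - (gfac z' * z' i k - y i ((j : ℕ) : ℤ)) =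
          gfac z * (z i k - z' i k) + (gfac z - gfac z') * z' i k := by ring
      rw [e1]
      refine (abs_add_le _ _).trans (add_le_add ?_ ?_)
      · rw [abs_mul]; exact mul_le_mul hg (hδz i k hk) (abs_nonneg _) (inv_nonneg.2 (Real.sqrt_nonneg _))
      · have e2 : A i k * ((1 / (2 * Real.sqrt eLo)) / eLo) * hmod A δz =
            ((1 / (2 * Real.sqrt eLo)) / eLo * hmod A δz) * A i k := by ring
        rw [abs_mul, e2]
        exact mul_le_mul hgg (hz'A i k hk) (abs_nonneg _) (mul_nonneg (by positivity) ((abs_nonneg _).trans hH))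
    · -- top row
      simp only [coord_some, resFormula, resLip, if_neg hj]
      have e1 : gfac z * Ttop i - y i ((j : ℕ) : ℤ) - (gfac z' * Ttop' i - y i ((j : ℕ) : ℤ)) =
          gfac z * (Ttop i - Ttop' i) + (gfac z - gfac z') * Ttop' i := by ring
      rw [e1]
      refine (abs_add_le _ _).trans (add_le_add ?_ ?_)
      · rw [abs_mul]; exact mul_le_mul hg (hδT i) (abs_nonneg _) (inv_nonneg.2 (Real.sqrt_nonneg _))
      · have e2 : TW i * ((1 / (2 * Real.sqrt eLo)) / eLo) * hmod A δz =
            ((1 / (2 * Real.sqrt eLo)) / eLo * hmod A δz) * TW i := by ring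
        rw [abs_mul, e2]
        exact mul_le_mul hgg (hT' i) (abs_nonneg _) (mul_nonneg (by positivity) ((abs_nonneg _).trans hH))

/-- `resLip` is linear in `(δz, δT)`: with `δz = χb B + χe E`, `δT = E` it splits as `GB · B + GE · E` where
`GB = resLip … χb 0`, `GE = resLip … χe 1`. [folklore] -/
theorem resLip_linear (A : Fin m → ℤ → ℝ) (eLo : ℝ) (TW : Fin m → ℝ) (χb χe : Fin m → ℤ → ℝ) (B E : ℝ)
    (r : F.WIdx) :
    F.resLip A eLo TW (fun i k => χb i k * B + χe i k * E) E r =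
      F.resLip A eLo TW χb 0 r * B + F.resLip A eLo TW χe 1 r * E := by
  have hH : hmod A (fun i k => χb i k * B + χe i k * E) = hmod A χb * B + hmod A χe * E := by
    simp only [hmod, Finset.sum_mul, ← Finset.sum_add_distrib]
    exact Finset.sum_congr rfl fun i _ => by ring
  rcases r with _ | ⟨i, j⟩
  · simp only [resLip, Finset.sum_mul, ← Finset.sum_add_distrib]
    exact Finset.sum_congr rfl fun i _ => by ring
  · by_cases hj : ((j : ℕ) : ℤ) + 1 < F.W
    · simp only [resLip, if_pos hj, hH]; ring
    · simp only [resLip, if_neg hj, hH]; ring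

/-- **(K2) FROM A TAIL-SENSITIVITY BOUND OF THE RUN.** Linear preconditioner `Cmat`; hull magnitudes `|runAt u| ≤ A`
on the window and a shell-1 energy floor `eLo > 0` for all `AdmLip` points; the tail-sensitivity bound
`|runAt u − runAt v|_{i,k} ≤ χb_{i,k} B + χe_{i,k} E` for `AdmLip` points with the same window part whose wake / top
tails differ by at most `B` / `E` on the flight (a Grönwall statement); and the two finite checks
`(Σ_{r'} |Cmat r r'| GB r') / S_r ≤ S_b`, `(Σ_{r'} |Cmat r r'| GE r') / S_r ≤ S_e` with `GB = resLip A eLo TW χb 0`,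
`GE = resLip A eLo TW χe 1`, `TW_i = |tubeC_{i,W}| + tubeR_W`. Then (K2) in the form consumed by `krawczyk_wedge`.
[cite: Tao2016AveragedNS, §5.3; cell vocabulary, harvest/h2-tao-ladder rung1/STAGE3-BANACH.md §2 ((H-lip)), rung1/RUNG1-P2G9-REPORT.md §37 (hWedge: S_b, S_e), rung1/RUNG1-P2G10-REPORT.md §43] -/
theorem K2_of_runTailSensitivity {ε₀ : ℝ} {α : Fin m → Fin m → Fin m → ℤ × ℤ × ℤ → ℝ} (hm : 0 < m)
    (hW1 : F.InWindow 1) (hD : F.InWindow F.D)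
    (C : F.WState × ℝ → F.WState × ℝ) {Cmat : F.WIdx → F.WIdx → ℝ}
    (hC : ∀ x r, F.coord (C x) r = ∑ r', Cmat r r' * F.coord x r') (R : ℤ → ℝ) {Sb Se : ℝ}
    {A : Fin m → ℤ → ℝ} {eLo : ℝ} (heLo : 0 < eLo) {χb χe : Fin m → ℤ → ℝ}
    (hA : ∀ u, F.AdmLip R u → ∀ i k, F.InWindow k → |F.runAt ε₀ α u i k| ≤ A i k)
    (he : ∀ u, F.AdmLip R u → eLo ≤ ∑ i, F.runAt ε₀ α u i 1 ^ 2)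
    (hsens : ∀ u v, F.AdmLip R u → F.AdmLip R v → u.1 = v.1 → u.2.1 = v.2.1 → ∀ B E : ℝ,
      (∀ i, ∀ t ∈ Icc 0 F.τhi, |F.decodeTail u i (-1) t - F.decodeTail v i (-1) t| ≤ B) →
      (∀ i, ∀ t ∈ Icc 0 F.τhi, |F.decodeTail u i F.W t - F.decodeTail v i F.W t| ≤ E) →
      ∀ i k, F.InWindow k → |F.runAt ε₀ α u i k - F.runAt ε₀ α v i k| ≤ χb i k * B + χe i k * E)
    (hSb : ∀ r, (∑ r', |Cmat r r'| *
      F.resLip A eLo (fun i => |F.tubeC i F.W| + F.tubeR F.W) χb 0 r') / F.bscale r ≤ Sb)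
    (hSe : ∀ r, (∑ r', |Cmat r r'| *
      F.resLip A eLo (fun i => |F.tubeC i F.W| + F.tubeR F.W) χe 1 r') / F.bscale r ≤ Se) :
    ∀ u v, F.AdmLip R u → F.AdmLip R v → u.1 = v.1 → u.2.1 = v.2.1 → ∀ B E : ℝ,
      (∀ i, ∀ t ∈ Icc 0 F.τhi, |F.decodeTail u i (-1) t - F.decodeTail v i (-1) t| ≤ B) →
      (∀ i, ∀ t ∈ Icc 0 F.τhi, |F.decodeTail u i F.W t - F.decodeTail v i F.W t| ≤ E) →
      (∀ i j, |(F.precondResidual ε₀ α C u).1 i j - (F.precondResidual ε₀ α C v).1 i j| ≤ Sb * B + Se * E) ∧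
        |(F.precondResidual ε₀ α C u).2 - (F.precondResidual ε₀ α C v).2| ≤ Sb * B + Se * E := by
  classical
  intro u v hu hv h1 h2 B E hB hE
  set TW : Fin m → ℝ := fun i => |F.tubeC i F.W| + F.tubeR F.W with hTW
  have ht0 : (0 : ℝ) ∈ Icc 0 F.τhi := ⟨le_rfl, F.τhi_pos.le⟩
  have hB0 : 0 ≤ B := (abs_nonneg _).trans (hB ⟨0, hm⟩ 0 ht0)
  have hE0 : 0 ≤ E := (abs_nonneg _).trans (hE ⟨0, hm⟩ 0 ht0)
  -- same window start and flight time
  have hy : F.preclampY u = F.preclampY v := by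
    funext i k; simp only [preclampY, h1]
  have hτ : F.preclampTau u = F.preclampTau v := by simp only [preclampTau, h2]
  -- the top tails at the common flight time
  have hWout : ¬ F.InWindow F.W := fun h => lt_irrefl _ h.2
  have hTT : ∀ i, |F.preclampTail u i F.W (F.preclampTau u) - F.preclampTail v i F.W (F.preclampTau v)| ≤ E :=
    fun i => by
      rw [hτ, F.preclampTail_eq_decodeTail hu.1 i hWout, F.preclampTail_eq_decodeTail hv.1 i hWout]
      exact hE i _ (F.preclampTau_mem v)
  have hT' : ∀ i, |F.preclampTail v i F.W (F.preclampTau v)| ≤ TW i := fun i => by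
    have h := F.abs_preclampTail_top_sub_le hv.1 i
    have e1 : F.preclampTail v i F.W (F.preclampTau v) =
        (F.preclampTail v i F.W (F.preclampTau v) - F.tubeC i F.W) + F.tubeC i F.W := by ring
    rw [e1]
    refine (abs_add_le _ _).trans ?_
    simp only [hTW]
    linarith
  -- the row-wise Lipschitz bound of the residual formula
  have hrow := F.abs_resFormula_sub_le hW1 hD heLo (δz := fun i k => χb i k * B + χe i k * E) (δT := E)
    (F.preclampY u) (hA u hu) (hA v hv) (he u hu) (he v hv) hT' (hsens u v hu hv h1 h2 B E hB hE) hTT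
  -- through the preconditioner
  have key : ∀ r, |F.coord (F.precondResidual ε₀ α C u) r - F.coord (F.precondResidual ε₀ α C v) r| ≤
      Sb * B + Se * E := by
    intro r
    have hs := F.bscale_pos r
    have hSb' : ∑ r', |Cmat r r'| * F.resLip A eLo TW χb 0 r' ≤ Sb * F.bscale r := (div_le_iff₀ hs).1 (hSb r)
    have hSe' : ∑ r', |Cmat r r'| * F.resLip A eLo TW χe 1 r' ≤ Se * F.bscale r := (div_le_iff₀ hs).1 (hSe r)
    rw [F.coord_precondResidual, F.coord_precondResidual, hC, hC, ← sub_div, ← Finset.sum_sub_distrib, abs_div,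
      abs_of_pos hs, div_le_iff₀ hs]
    calc |∑ r', (Cmat r r' * F.coord (F.gval ε₀ α u) r' - Cmat r r' * F.coord (F.gval ε₀ α v) r')|
        ≤ ∑ r', |Cmat r r'| * F.resLip A eLo TW (fun i k => χb i k * B + χe i k * E) E r' := by
          refine (Finset.abs_sum_le_sum_abs _ _).trans (Finset.sum_le_sum fun r' _ => ?_)
          rw [← mul_sub, abs_mul]
          refine mul_le_mul_of_nonneg_left ?_ (abs_nonneg _)
          rw [F.gval_eq_resFormula ε₀ α u, F.gval_eq_resFormula ε₀ α v, ← hy]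
          exact hrow r'
      _ = (∑ r', |Cmat r r'| * F.resLip A eLo TW χb 0 r') * B + (∑ r', |Cmat r r'| * F.resLip A eLo TW χe 1 r') * E := by
          rw [Finset.sum_mul, Finset.sum_mul, ← Finset.sum_add_distrib]
          exact Finset.sum_congr rfl fun r' _ => by rw [F.resLip_linear]; ring
      _ ≤ Sb * F.bscale r * B + Se * F.bscale r * E := by gcongr
      _ = (Sb * B + Se * E) * F.bscale r := by ring
  refine ⟨fun i j => ?_, ?_⟩
  · have h := key (some (i, j)); simpa using h
  · have h := key none; simpa using h

end OneShiftFrame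

end DSSOneShift

end Summit.NavierStokesRegularity.NavierStokesRegularity.Theorems
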